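import Mathlib
import Summits.MatrixMultiplication.Statement
import Summits.MatrixMultiplication.MatrixMultiplication.Theorems.GraphEquationsTowerTransport
import Summits.MatrixMultiplication.MatrixMultiplication.Theorems.GraphEquationsTowerPoint
import Summits.MatrixMultiplication.MatrixMultiplication.Theorems.GraphEquationsRecentring
import Summits.MatrixMultiplication.MatrixMultiplication.Theorems.GraphEquationsGrowthDial

/-!
# Graph equations — the tower supply S1, unconditionally (M25d)

`towerSupply` proves, for every exponent `m ≥ 1`, the tower-supply hypothesis `hS1` of
`familyRung_of_towerSupply` / `multiplicityReduction_of_logGapHand_of_towerSupply` /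
`matrixMultiplication_iff_quadratic_logGapHand_of_towerSupply` (NODE-g35 §6, NODE-g36 §3):

E1 the identity tower over `ℂ(a,b)` with kernel coordinates `Fin a` (`exists_towerStages_fin`),
E2 its cleared identities (`towerCleared_of_stages`), E3 the `ℂ`-point and 2-jet section
(`towerPoint_of_cleared`), S4 the plumbing: `θ₀ = X`, `θ₁` the affine recentring at the point with
the `c`-shear `linC` and the affine truncations of the section jets, `Q = J - affTrunc J`,
`τ = θ₁ ∘ outputs`, `P` the `ℂ` read-out matrix.

Corollaries: `familyRung` (the rung `R(⟨n,n,n⟩) ≤ 2·3^{m-1}·N` for every local exponent `m`,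
unconditionally), `multiplicityReduction_of_logGapHand` (the crux `MultiplicityReduction` from the
hand `LogGapHand` alone) and `matrixMultiplication_iff_quadratic_logGapHand`
(`ω = 2 ↔ GraphEquationsQuadratic ∧ LogGapHand`).
-/

set_option linter.dupNamespace false

noncomputable section

open scoped BigOperators

namespace Summit.MatrixMultiplication.MatrixMultiplication.Theorems.GraphEquations

open MvPolynomial
open Literature.Computability.AlgebraicComplexity

variable {n : ℕ}

section Shear

/-- The affine part of the shifted product `∑_k (p_a + a)(p_b + b)` defining `c_q` on the graph:
the `c`-SHEAR of the recentring. -/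
def linC (p : MatMulVars n → ℂ) (q : Fin n × Fin n) : MvPolynomial (MatMulVars n) ℂ :=
  ∑ k, (C (p (Sum.inl (q.1, k)) * p (Sum.inr (k, q.2))) +
    C (p (Sum.inl (q.1, k))) * X (Sum.inr (k, q.2)) + C (p (Sum.inr (k, q.2))) * X (Sum.inl (q.1, k)))

/-- The `c`-shear is cost-free. -/
theorem linC_mem_freeSpan (p : MatMulVars n → ℂ) (q : Fin n × Fin n) : linC p q ∈ freeSpan ∅ := by
  refine Submodule.sum_mem _ fun k _ => Submodule.add_mem _ (Submodule.add_mem _ (C_mem_freeSpan _ _) ?_) ?_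
  · rw [← smul_eq_C_mul]; exact Submodule.smul_mem _ _ (X_mem_freeSpan _ _)
  · rw [← smul_eq_C_mul]; exact Submodule.smul_mem _ _ (X_mem_freeSpan _ _)

/-- **Shear identity**: `linC p q + ∑_k a_{q₁k} b_{kq₂} = (∑_k a b)(p + ·)`. -/
theorem linC_add_graph (p : MatMulVars n → ℂ) (q : Fin n × Fin n) :
    linC p q + graphRestrict n (X (Sum.inr q) : MvPolynomial (GraphVars n) ℂ) =
      shiftHom p (graphRestrict n (X (Sum.inr q) : MvPolynomial (GraphVars n) ℂ)) := by
  rw [graphRestrict_X_inr, map_sum, linC, ← Finset.sum_add_distrib]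
  refine Finset.sum_congr rfl fun k _ => ?_
  rw [map_mul (shiftHom p) (X _) (X _), shiftHom_X, shiftHom_X, C_mul]
  ring

/-- Constant term of the shear: the value of `∑_k a b` at `p`. -/
theorem constantCoeff_linC (p : MatMulVars n → ℂ) (q : Fin n × Fin n) :
    constantCoeff (linC p q) =
      aeval p (graphRestrict n (X (Sum.inr q) : MvPolynomial (GraphVars n) ℂ)) := by
  have h := congrArg constantCoeff (linC_add_graph p q)
  rw [map_add, constantCoeff_shiftHom] at h
  have h0 : constantCoeff (graphRestrict n (X (Sum.inr q) : MvPolynomial (GraphVars n) ℂ)) = 0 := by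
    rw [graphRestrict_X_inr, map_sum]
    exact Finset.sum_eq_zero fun k _ => by rw [map_mul, constantCoeff_X, constantCoeff_X, mul_zero]
  rwa [h0, add_zero] at h

end Shear

section Supply

/-- `rename Sum.inl` as the substitution `w ↦ X (inl w)` after `θ₀ = X`. -/
theorem aeval_X_inl_aeval_X {a : ℕ} (t : MvPolynomial (GraphVars n) ℂ) :
    aeval (fun w : GraphVars n => (X (Sum.inl w) : MvPolynomial (GraphVars n ⊕ Fin a) ℂ))
      (aeval (fun v : GraphVars n => (X v : MvPolynomial (GraphVars n) ℂ)) t) = rename Sum.inl t := by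
  rw [aeval_X_left_apply]
  induction t using MvPolynomial.induction_on with
  | C c => rw [aeval_C, rename_C]; rfl
  | add f g hf hg => rw [map_add, map_add, hf, hg]
  | mul_X f v hf => rw [map_mul, map_mul, hf, aeval_X, rename_X]

set_option maxHeartbeats 1600000 in
/-- **The tower supply S1, for every exponent `m ≥ 1`.** -/
theorem towerSupply : ∀ m : ℕ, 1 ≤ m → ∀ n : ℕ, 1 ≤ n → ∀ (N T : ℕ)
    (t : Fin T → MvPolynomial (GraphVars n) ℂ),
      (∀ o, t o ∈ graphIdeal n) →
      (∃ gs : List (MvPolynomial (GraphVars n) ℂ), IsNonscalarSeq gs ∧ gs.length ≤ N ∧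
        ∀ o, t o ∈ freeSpan {q | q ∈ gs}) →
      (∀ q : Fin n × Fin n, generator n q ^ m ∈ Ideal.span (Set.range t)) →
      ∃ (a b c : ℕ) (θ₀ : GraphVars n → MvPolynomial (GraphVars n) ℂ)
        (Ds : List (Derivation ℂ (MvPolynomial (GraphVars n ⊕ Fin a) ℂ)
          (MvPolynomial (GraphVars n ⊕ Fin a) ℂ)))
        (word : Fin b → List (Derivation ℂ (MvPolynomial (GraphVars n ⊕ Fin a) ℂ)
          (MvPolynomial (GraphVars n ⊕ Fin a) ℂ)))
        (θ₁ : GraphVars n ⊕ Fin a → MvPolynomial (GraphVars n ⊕ Fin a) ℂ)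
        (τ : (Fin T × Fin b) ⊕ Fin c → MvPolynomial (GraphVars n ⊕ Fin a) ℂ)
        (Q : Fin a → MvPolynomial (MatMulVars n) ℂ)
        (P : Fin n × Fin n → (Fin T × Fin b) ⊕ Fin c → ℂ),
        Ds.length + 1 ≤ m ∧
        (∀ v, θ₀ v ∈ freeSpan (∅ : Set (MvPolynomial (GraphVars n) ℂ))) ∧
        (∀ D ∈ Ds, ∀ v, D (X v) ∈ freeSpan (∅ : Set (MvPolynomial (GraphVars n ⊕ Fin a) ℂ))) ∧
        (∀ w, (word w).Sublist Ds) ∧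
        (∀ v, θ₁ v ∈ freeSpan (∅ : Set (MvPolynomial (GraphVars n ⊕ Fin a) ℂ))) ∧
        (∀ ow : Fin T × Fin b, τ (Sum.inl ow) =
          bind₁ θ₁ ((word ow.2).foldl (fun acc D => D acc)
            (aeval (fun w : GraphVars n => (X (Sum.inl w) : MvPolynomial (GraphVars n ⊕ Fin a) ℂ))
              (aeval θ₀ (t ow.1))))) ∧
        (∀ x : Fin c, τ (Sum.inr x) ∈ freeSpan (∅ : Set (MvPolynomial (GraphVars n ⊕ Fin a) ℂ))) ∧
        (∀ i, coeff 0 (Q i) = 0) ∧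
        (∀ i (w : MatMulVars n), coeff (Finsupp.single w 1) (Q i) = 0) ∧
        (∀ o (i j j' l : Fin n),
          coeff (Finsupp.single (Sum.inl (i, j) : MatMulVars n) 1 +
              Finsupp.single (Sum.inr (j', l) : MatMulVars n) 1)
            (bind₁ (Sum.elim (fun v => graphRestrict n (X v)) Q) (τ o)) = 0) ∧
        (∀ q q' : Fin n × Fin n,
          ∑ o, P q o * coeff (Finsupp.single (Sum.inl (Sum.inr q') : GraphVars n ⊕ Fin a) 1) (τ o) =
            if q = q' then 1 else 0) ∧
        (∀ (q : Fin n × Fin n) (i' : Fin a),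
          ∑ o, P q o * coeff (Finsupp.single (Sum.inr i' : GraphVars n ⊕ Fin a) 1) (τ o) = 0) := by
  intro m hm n hn N T t ht _hN hgen
  classical
  -- E1: the identity tower over `ℂ(a,b)` with kernel coordinates `Fin a`
  obtain ⟨a, Ds, W, ex, lam, hlen, hsub, hDs, hex, hvanW, hvanE, hspan⟩ :=
    exists_towerStages_fin (K := FractionRing (MvPolynomial (MatMulVars n) ℂ)) t ht hm hgen
  -- E2: cleared identities
  obtain ⟨Nn, d, M, Cn, p, hp, hout, hM2, hdual⟩ :=
    towerCleared_of_stages t W ex lam hvanW hvanE hspan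
  -- E3: the `ℂ`-point and the 2-jet section
  obtain ⟨ι, PC, hJc, hjet, hP⟩ := towerPoint_of_cleared t W ex Nn d M Cn p hp hout hM2 hdual
  -- S4: the witnesses
  set J : Fin a → MvPolynomial (MatMulVars n) ℂ := fun x => shiftHom p (Nn x) * ι with hJ
  set L : GraphVars n ⊕ Fin a → MvPolynomial (MatMulVars n) ℂ :=
    Sum.elim (Sum.elim (fun u => C (p u)) (fun q => linC p q)) (fun i => affTrunc (J i)) with hL
  set ii : MatMulVars n → GraphVars n ⊕ Fin a := fun u => Sum.inl (Sum.inl u) with hii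
  set θ₁ : GraphVars n ⊕ Fin a → MvPolynomial (GraphVars n ⊕ Fin a) ℂ := recentre ii L with hθ₁
  set Q : Fin a → MvPolynomial (MatMulVars n) ℂ := fun i => J i - affTrunc (J i) with hQ
  set out := towerOut t W ex with hout'
  set τ : (Fin T × Fin W.length) ⊕ Fin ex.length → MvPolynomial (GraphVars n ⊕ Fin a) ℂ :=
    Sum.elim (fun ow => bind₁ θ₁ ((W.get ow.2).foldl (fun acc D => D acc)
      (aeval (fun w : GraphVars n => (X (Sum.inl w) : MvPolynomial (GraphVars n ⊕ Fin a) ℂ))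
        (aeval (fun v : GraphVars n => (X v : MvPolynomial (GraphVars n) ℂ)) (t ow.1)))))
      (fun x => bind₁ θ₁ (ex.get x)) with hτ
  -- basic facts
  have hLfree : ∀ v, L v ∈ freeSpan ∅ := by
    rintro ((u | q) | i)
    · exact C_mem_freeSpan _ _
    · exact linC_mem_freeSpan p q
    · exact affTrunc_mem_freeSpan _
  have hθ₁free : ∀ v, θ₁ v ∈ freeSpan ∅ := recentre_mem_freeSpan ii hLfree
  have hτout : ∀ o, τ o = bind₁ θ₁ (out o) := by
    rintro (⟨o, w⟩ | x)
    · simp only [hτ, Sum.elim_inl, aeval_X_inl_aeval_X]; rfl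
    · rfl
  -- the substitution `Φ = (graph restriction, Q)` fixes the base variables
  have hΦ : ∀ u, Sum.elim (fun v => graphRestrict n (X v)) Q (ii u) = X u := fun u => by
    simp [hii]
  -- `L + Φ` is the shifted graph point with the section jets
  have hψ : (fun v => L v + Sum.elim (fun v => graphRestrict n (X v)) Q v) =
      Sum.elim (fun v => shiftHom p (graphRestrict n (X v))) J := by
    funext v
    rcases v with (u | q) | i
    · simp [hL, shiftHom_X]
    · simp only [hL, Sum.elim_inl, Sum.elim_inr]; exact linC_add_graph p q
    · simp only [hL, hQ, Sum.elim_inr]; ring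
  -- the constants of `L` are the `ℂ`-point
  have hL0 : (fun v => constantCoeff (L v)) = Sum.elim (fun v => aeval p (graphRestrict n (X v)))
      (fun x => aeval p (Nn x) * (aeval p d)⁻¹) := by
    funext v
    rcases v with (u | q) | i
    · simp [hL]
    · simp only [hL, Sum.elim_inl, Sum.elim_inr]; exact constantCoeff_linC p q
    · simp only [hL, Sum.elim_inr, constantCoeff_affTrunc]; exact hJc i
  have hc_notMem : ∀ q' : Fin n × Fin n, (Sum.inl (Sum.inr q') : GraphVars n ⊕ Fin a) ∉ Set.range ii := by
    rintro q' ⟨u, hu⟩; simp [hii] at hu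
  have hl_notMem : ∀ i' : Fin a, (Sum.inr i' : GraphVars n ⊕ Fin a) ∉ Set.range ii := by
    rintro i' ⟨u, hu⟩; simp [hii] at hu
  refine ⟨a, W.length, ex.length, fun v => X v, Ds, fun w => W.get w, θ₁, τ, Q,
    fun q o => PC (Sum.inl q) o, by omega, fun v => X_mem_freeSpan _ v, fun D hD => (hDs D hD).1,
    fun w => hsub _ (List.get_mem _ _), hθ₁free, fun ow => rfl,
    fun x => bind₁_mem_freeSpan_empty θ₁ hθ₁free (hex _ (List.get_mem _ _)),
    fun i => coeff_zero_sub_affTrunc (J i), fun i w => coeff_single_sub_affTrunc (J i) w,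
    fun o i j j' l => ?_, fun q q' => ?_, fun q i' => ?_⟩
  · -- hsec: the 2-jet identities
    rw [hτout, hθ₁, bind₁_bind₁_recentre ii L hΦ, hψ]
    exact coeff_eq_zero_of_mem_jetIdeal_two (hjet o) _ _
  · -- hPc
    have h := hP (Sum.inl q) (Sum.inl q')
    simp only [Sum.inl.injEq] at h
    rw [← h]
    refine Finset.sum_congr rfl fun o _ => ?_
    rw [hτout, hθ₁, coeff_single_bind₁_recentre ii L (hc_notMem q'), hL0]
    rfl
  · -- hPΛ
    have h := hP (Sum.inl q) (Sum.inr i')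
    rw [if_neg Sum.inl_ne_inr] at h
    rw [← h]
    refine Finset.sum_congr rfl fun o _ => ?_
    rw [hτout, hθ₁, coeff_single_bind₁_recentre ii L (hl_notMem i'), hL0]
    rfl

/-- **The family rung, unconditionally**: for every local exponent `m ≥ 1` and every `ε > 0`,
`R(⟨n,n,n⟩) ≤ C(m) · n^ε · (N + n²)` for graph-equation families of exponent `m`. -/
theorem familyRung {m : ℕ} (hm : 1 ≤ m) :
    ∀ ε : ℝ, 0 < ε → ∃ C : ℝ, ∀ n : ℕ, 1 ≤ n → ∀ (N T : ℕ) (t : Fin T → MvPolynomial (GraphVars n) ℂ),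
      (∀ o, t o ∈ graphIdeal n) →
      (∃ gs : List (MvPolynomial (GraphVars n) ℂ), IsNonscalarSeq gs ∧ gs.length ≤ N ∧
        ∀ o, t o ∈ freeSpan {q | q ∈ gs}) →
      (∀ q : Fin n × Fin n, generator n q ^ m ∈ Ideal.span (Set.range t)) →
      (tensorRank (matMulTensor ℂ n n n) : ℝ) ≤ C * (n : ℝ) ^ ε * ((N : ℝ) + n * n) :=
  familyRung_of_towerSupply (towerSupply m hm)

/-- **The crux from the hand alone**: `LogGapHand → MultiplicityReduction`. -/
theorem multiplicityReduction_of_logGapHand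
    (hL : ∀ β : ℝ, 2 ≤ β → EqAdmissible β → ∀ β' : ℝ, β < β' →
      ∃ c : ℝ, ∀ n : ℕ, 1 ≤ n → ∃ (m N T : ℕ) (t : Fin T → MvPolynomial (GraphVars n) ℂ),
        1 ≤ m ∧ (∀ o, t o ∈ graphIdeal n) ∧
        (∃ gs : List (MvPolynomial (GraphVars n) ℂ), IsNonscalarSeq gs ∧ gs.length ≤ N ∧
          ∀ o, t o ∈ freeSpan {q | q ∈ gs}) ∧
        (∀ q : Fin n × Fin n, generator n q ^ m ∈ Ideal.span (Set.range t)) ∧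
        ((2 * 3 ^ (m - 1) : ℕ) : ℝ) * (N : ℝ) ≤ c * (n : ℝ) ^ β') :
    MultiplicityReduction :=
  multiplicityReduction_of_logGapHand_of_towerSupply towerSupply hL

/-- **The summit, reformulated unconditionally**: `ω(ℂ) = 2 ↔ GraphEquationsQuadratic ∧ LogGapHand`
(the hand: graph-equation families whose tower multiplier `2·3^{m-1}·N` is `O(n^{β'})`). -/
theorem matrixMultiplication_iff_quadratic_logGapHand :
    _root_.MatrixMultiplication ↔
      GraphEquationsQuadratic ∧
      (∀ β : ℝ, 2 ≤ β → EqAdmissible β → ∀ β' : ℝ, β < β' →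
        ∃ c : ℝ, ∀ n : ℕ, 1 ≤ n → ∃ (m N T : ℕ) (t : Fin T → MvPolynomial (GraphVars n) ℂ),
          1 ≤ m ∧ (∀ o, t o ∈ graphIdeal n) ∧
          (∃ gs : List (MvPolynomial (GraphVars n) ℂ), IsNonscalarSeq gs ∧ gs.length ≤ N ∧
            ∀ o, t o ∈ freeSpan {q | q ∈ gs}) ∧
          (∀ q : Fin n × Fin n, generator n q ^ m ∈ Ideal.span (Set.range t)) ∧
          ((2 * 3 ^ (m - 1) : ℕ) : ℝ) * (N : ℝ) ≤ c * (n : ℝ) ^ β') :=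
  matrixMultiplication_iff_quadratic_logGapHand_of_towerSupply towerSupply

/-- **Unconditional tower multiplier**: for a graph-equation family of local exponent `m ≥ 1` with
`N` non-scalar products, `R(⟨n,n,n⟩) ≤ 2 · 3^{m-1} · N`. -/
theorem tensorRank_le_towerMultiplier {m : ℕ} (hm : 1 ≤ m) {n : ℕ} (hn : 1 ≤ n) {N T : ℕ}
    (t : Fin T → MvPolynomial (GraphVars n) ℂ) (ht : ∀ o, t o ∈ graphIdeal n)
    (hN : ∃ gs : List (MvPolynomial (GraphVars n) ℂ), IsNonscalarSeq gs ∧ gs.length ≤ N ∧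
      ∀ o, t o ∈ freeSpan {q | q ∈ gs})
    (hgen : ∀ q : Fin n × Fin n, generator n q ^ m ∈ Ideal.span (Set.range t)) :
    tensorRank (matMulTensor ℂ n n n) ≤ 2 * 3 ^ (m - 1) * N :=
  tensorRank_le_towerMultiplier_of_towerSupply (towerSupply m hm) n hn N T t ht hN hgen

end Supply

end Summit.MatrixMultiplication.MatrixMultiplication.Theorems.GraphEquations

end
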